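import Summits.BirchSwinnertonDyer.Rank1Residual.X11b.BDPRouteTamagawaSupport
import Literature.NumberTheory.EllipticCurves.SemistablePeuRamifieRamifiedPrime
import Literature.NumberTheory.DiophantineGeometry.DenesEquationSerreRoadProofs
import Literature.NumberTheory.EllipticCurves.RootNumberProofs
import Literature.NumberTheory.DiophantineGeometry.PastenValuationProductsProofs
import Literature.NumberTheory.EllipticCurves.ModularCurveNewformDimension
import HarnessLib

/-!
# Route `ErratumRoadFive` (K2, `p ≥ 5`), crux `EulerHalfNotRamNoInertSetAtFive` (item stmt-BirchSwinnertonDyer-19715), line `birth`: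
# THE LEVEL-LOWERING CUT — on the all-carriers locus (`E[p]` unramified at every multiplicative prime) the self-carrier `p ∣ ord_p Δ_min`
# is EXCLUDED whenever the additive conductor of `E` is `1`, a power of `2` dividing `16`, `9`, or `25`
# (cell `bsd-stepL`, lead seat `bsd-line-er5-p1` g1; `--supports stmt-BirchSwinnertonDyer-19715 --as helper`)

WHAT. The arithmetic core of the v10 cut of the residual of line `birth`, adapted (proofs verbatim) from the ideator's kernel-checked crux workfile
`Cruxes/EulerHalfNotRamNoInertSetAtFive/Lines/level_lowering_cut.lean` §3–§4c (bsd-idea-9 g3, 2026-08-28; not importable from `Theorems/`), def-free.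
THE LEVER: on 19715's locus (`p ≥ 5` multiplicative, `E[p]` irreducible, NO (ram) prime, so every multiplicative `ℓ ≠ p` is a `p`-carrier and `E[p]`
is unramified at `ℓ`) the self-carrier condition `p ∣ ord_p(Δ_min)` makes `E[p]` finite (peu ramifié) at `p`: Serre weight `2`, Serre level
`N(ρ̄) ∣ N_add(E)`. Ribet–Diamond level lowering gives a weight-2 newform of level `M = N(ρ̄)`; when `p ∤ φ(M)` its nebentypus is trivial and when
`S₂(Γ₀(M)) = 0` this is absurd. Hence `p ∤ ord_p(Δ_min)` on: semistable curves (`M = 1`; tree theorem `ram_of_semistable_of_irr_of_mult_of_dvd`),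
and curves whose bad primes `≠ r` are all multiplicative with `r^(k+1) ∤ N_E` for `(r, k) ∈ {(2,4), (3,2), (5,2)}` (`M ∣ 16, 9, 25`: genus-0 levels).

* §1 `not_dvd_ordp_of_semistable_of_not_ram`, `exists_otherMult_of_semistable_of_dvd_tamagawaProduct` — the semistable cut and its Tamagawa corollary
  (and at `p ≤ 7` the semistable ¬(ram) locus is EMPTY: tree theorem `ram_of_semistable_of_irr_of_le_seven`).
* §2 `not_dvd_ordp_of_primePowerAdditive_of_not_ram` — the prime-power-additive core with a totient side condition and a vanishing oracle for the
  levels `M ∣ r^k`; instances `…_of_twoPowerAdditive_…` (`2⁵ ∤ N_E`), `…_of_threeSquareAdditive_…` (`3³ ∤ N_E`), `…_of_fiveSquareAdditive_…` (`5³ ∤ N_E`,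
  `p ≥ 7`; at `p = 5` the locus is semistable) and the uniform `p ≥ 5` wrappers `not_dvd_ordp_of_locusTwo/Three/Five_of_not_ram`.

PRINTED INPUTS, BY NAME (hypotheses, not asserted): modularity `exists_isNewformOf` (a conjunct of the route item `PublishedInputsFive`), Diamond's refined
level lowering `diamond1995_refinedSerre` [Ribet 1990 Thm 1.1 + Diamond 1995 Thm 1.1], and the exponentwise Ogg–Saito identity
`WeierstrassCurve.artinConductorExponent_tate_eq_conductorExponent_of_isElliptic` [Ogg 1967, Saito 1988] (only for `N(ρ̄) ∣ N_E`; not needed in §1).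
HONEST FRAMING: THEOREMS ONLY, CONDITIONAL on those named facts; no `sorry`, no definition, no new named fact; nothing booked; item 19715 is NOT closed;
BSD is proved for no curve; no summit statement is touched. Credit: bsd-idea-9 g3 (statements and proofs); the lead only moved them to `Theorems/`.
[cite: Ribet1990, Thm. 1.1] [cite: Diamond1995RefinedSerre, Thm. 1.1] [cite: Serre1987, §2.8 Prop. 4, §4.1 (4.1.12)] [cite: DiamondShurman2005, Thm. 3.5.1] -/

set_option autoImplicit false
set_option linter.dupNamespace false

noncomputable section

open scoped Classical MatrixGroups ModularForm NumberField

open WeierstrassCurve Literature.NumberTheory Literature.NumberTheory.GaloisRepresentations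
  Literature.NumberTheory.EllipticCurves Literature.NumberTheory.EllipticCurves.ModularForms
  Rat.HeightOneSpectrum IsDedekindDomain IsDedekindDomain.HeightOneSpectrum
  Literature.NumberTheory.Automorphic Literature.NumberTheory.Automorphic.BCDT
  Literature.NumberTheory.DiophantineGeometry Literature.NumberTheory.EllipticCurves.Rank1Residual
  Literature.NumberTheory.GaloisRepresentations.ModPGaloisRep
  Literature.NumberTheory.GaloisRepresentations.IsNonarchimedeanLocalField
  Literature.NumberTheory.EllipticCurves.SkinnerUrban2014 ValuativeRel CongruenceSubgroup Polynomial
  Summit.BirchSwinnertonDyer.Rank1Residual Summit.BirchSwinnertonDyer.Rank1Residual.X11b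

namespace Summit.BirchSwinnertonDyer.BirchSwinnertonDyer.Theorems.EulerHalfLevelLoweringCut

/-! ### §1 The semistable cut -/

/-- **(W)-witness at `p` for free on semistable curves.** `E` semistable, `p ≥ 5` multiplicative, `E[p]` irreducible and NO (ram) prime
⟹ `p ∤ ord_p(Δ_min)`: otherwise `E[p] ⊗ 𝔽̄_p` is irreducible, odd, modular, of Serre level `1` and Serre weight `2`, and Ribet–Diamond level lowering
produces a weight-2 cusp form of level `1`. Contrapositive of the TREE theorem `ram_of_semistable_of_irr_of_mult_of_dvd`.
[cite: Ribet1990, Thm. 1.1] [cite: Diamond1995RefinedSerre, Thm. 1.1] [cite: Serre1987, §4.1 (4.1.12)] -/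
theorem not_dvd_ordp_of_semistable_of_not_ram (hnf : exists_isNewformOf) (hLL : diamond1995_refinedSerre)
    (W : WeierstrassCurve ℚ) [W.IsElliptic] [W.IsGloballyMinimal] (p : ℕ) [Fact p.Prime]
    (hp5 : 5 ≤ p) (hMp : Mult W p) (hirr : Irr W p) (hsst : Semistable W) (hnram : ¬ Ram W p) :
    ¬ p ∣ padicValInt p W.minimalDiscriminantInt := fun h ↦
  hnram (ram_of_semistable_of_irr_of_mult_of_dvd hnf hLL W p (by omega) hMp h hsst hirr)

/-- **At `p ∈ {5, 7}` a semistable pair with `E[p]` irreducible HAS a (ram) prime** (tree theorem `ram_of_semistable_of_irr_of_le_seven`: Serre weight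
`≤ p + 1 ≤ 8 < 12`, no level-one forms), so the ¬(ram) locus of 19715 is empty there. [cite: Ribet1990, Thm. 1.1] [cite: Serre1987, §2.8 Prop. 4] -/
theorem ram_of_semistable_of_le_seven (hnf : exists_isNewformOf) (hLL : diamond1995_refinedSerre)
    (W : WeierstrassCurve ℚ) [W.IsElliptic] [W.IsGloballyMinimal] (p : ℕ) [Fact p.Prime]
    (hp5 : 5 ≤ p) (hp7 : p ≤ 7) (hirr : Irr W p) (hsst : Semistable W) : Ram W p :=
  ram_of_semistable_of_irr_of_le_seven hnf hLL W p (by omega) hp7 hsst hirr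

/-- **A second multiplicative prime on the Tamagawa locus of a semistable pair** (`p ∣ ∏ c_ℓ` iff some SPLIT multiplicative `ℓ` has `p ∣ ord_ℓ(Δ_min)`,
tree `dvd_tamagawaProduct_iff_exists_split`; `ℓ = p` is excluded by §1): piece S1b is EMPTY on semistable curves. [cite: SilvermanATAEC1994, Cor. IV.9.2(d)] -/
theorem exists_otherMult_of_semistable_of_dvd_tamagawaProduct (hnf : exists_isNewformOf) (hLL : diamond1995_refinedSerre)
    (W : WeierstrassCurve ℚ) [W.IsElliptic] [W.IsGloballyMinimal] (p : ℕ) [Fact p.Prime]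
    (hp5 : 5 ≤ p) (hMp : Mult W p) (hirr : Irr W p) (hsst : Semistable W) (hnram : ¬ Ram W p)
    (htam : p ∣ W.tamagawaProduct) :
    ∃ ℓ : ℕ, ∃ _ : Fact ℓ.Prime, ℓ ≠ p ∧ W.HasMultiplicativeReductionAtPrime ℓ := by
  have hp : p.Prime := Fact.out
  obtain ⟨ℓ, _, hs, hd⟩ := (dvd_tamagawaProduct_iff_exists_split W hp hp5).mp htam
  refine ⟨ℓ, ‹_›, ?_, hs.hasMultiplicativeReductionAtPrime⟩
  rintro rfl
  exact not_dvd_ordp_of_semistable_of_not_ram hnf hLL W ℓ hp5 hMp hirr hsst hnram hd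

/-- **A semistable curve lies on the 3-square locus** («every prime `≠ 3` good or multiplicative, `3³ ∤ N_E`»): bookkeeping (`N_E` is squarefree). -/
theorem threeSquareLocus_of_semistable (W : WeierstrassCurve ℚ) [W.IsElliptic] [W.IsGloballyMinimal] (hsst : Semistable W) :
    (∀ (ℓ : ℕ) [Fact ℓ.Prime], ℓ ≠ 3 → W.HasGoodReductionAtPrime ℓ ∨ W.HasMultiplicativeReductionAtPrime ℓ) ∧
      ¬ 3 ^ 3 ∣ W.conductorNorm ℤ := by
  refine ⟨fun ℓ _ _ ↦ hsst ℓ Fact.out, fun h27 ↦ ?_⟩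
  have hsq : Squarefree (W.conductorNorm ℤ) :=
    (W.isSemistable_iff_squarefree_conductorNorm).mp ((semistable_iff_isSemistable_int W).mp hsst)
  have h9 : 3 * 3 ∣ W.conductorNorm ℤ := (show (3 * 3 : ℕ) ∣ 3 ^ 3 by norm_num).trans h27
  exact absurd (hsq 3 h9) (by decide)

/-! ### §2 The prime-power-additive cut -/

/-- Arithmetic: a non-zero natural number all of whose prime factors equal `r`, dividing a number not divisible by `r^(k+1)`, divides `r^k`. -/
theorem dvd_primePow_of_forall_prime_dvd_eq {L N r k : ℕ} (hL0 : L ≠ 0)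
    (hq : ∀ q : ℕ, q.Prime → q ∣ L → q = r) (hLN : L ∣ N) (hk : ¬ r ^ (k + 1) ∣ N) :
    L ∣ r ^ k := by
  have hL : L = r ^ L.primeFactorsList.length :=
    Nat.eq_prime_pow_of_unique_prime_dvd hL0 (fun hd hdL ↦ hq _ hd hdL)
  set a := L.primeFactorsList.length with ha
  have hak : a ≤ k := by
    by_contra hak
    exact hk ((Nat.pow_dvd_pow r (by omega)).trans (hL ▸ hLN))
  rw [hL]
  exact Nat.pow_dvd_pow r hak

/-- `p ∤ φ(M)` for `M ∣ 9` and `p ≥ 5` prime (`φ(M) ∈ {1, 2, 6}`). -/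
theorem not_dvd_totient_of_dvd_nine {M p : ℕ} (hM : M ∣ 9) (hp : p.Prime) (hp5 : 5 ≤ p) :
    ¬ p ∣ Nat.totient M := by
  intro h
  obtain ⟨i, hi, rfl⟩ := (Nat.dvd_prime_pow Nat.prime_three).mp (show M ∣ 3 ^ 2 by simpa using hM)
  have hφ : Nat.totient (3 ^ i) ∣ 6 := by
    interval_cases i <;> decide
  rcases (Nat.Prime.dvd_mul hp).mp (show p ∣ 2 * 3 from h.trans hφ) with h2 | h3
  · have := (Nat.prime_dvd_prime_iff_eq hp Nat.prime_two).mp h2; omega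
  · have := (Nat.prime_dvd_prime_iff_eq hp Nat.prime_three).mp h3; omega

/-- `p ∤ φ(M)` for `M ∣ 25` and `p ≥ 7` prime (`φ(M) ∈ {1, 4, 20}`). -/
theorem not_dvd_totient_of_dvd_twentyFive {M p : ℕ} (hM : M ∣ 25) (hp : p.Prime) (hp7 : 7 ≤ p) :
    ¬ p ∣ Nat.totient M := by
  intro h
  obtain ⟨i, hi, rfl⟩ := (Nat.dvd_prime_pow Nat.prime_five).mp (show M ∣ 5 ^ 2 by simpa using hM)
  have hφ : Nat.totient (5 ^ i) ∣ 20 := by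
    interval_cases i <;> decide
  rcases (Nat.Prime.dvd_mul hp).mp (show p ∣ 2 ^ 2 * 5 from h.trans hφ) with h2 | h5
  · have := (Nat.prime_dvd_prime_iff_eq hp Nat.prime_two).mp (hp.dvd_of_dvd_pow h2); omega
  · have := (Nat.prime_dvd_prime_iff_eq hp Nat.prime_five).mp h5; omega

/-- **`S₂(Γ₀(M)) = 0` for `M ∣ 25`** (`X₀(1), X₀(5), X₀(25)` have genus `0`): levels `≤ 10` by the tree's `cuspForm_two_gamma0_eq_zero_of_le_ten`, level `25`
by the tree's genus formula `finrank_cuspForm_two_eq_genusX0_of_mem` with `gamma0_data_25`. [cite: DiamondShurman2005, Thm. 3.5.1] -/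
theorem cuspForm_two_gamma0_eq_zero_of_dvd_twentyFive {M : ℕ} [NeZero M] (hM : M ∣ 25)
    (f : CuspForm (Gamma0 M) 2) : f = 0 := by
  have hM' : M = 1 ∨ M = 5 ∨ M = 25 := by
    obtain ⟨i, hi, hMi⟩ := (Nat.dvd_prime_pow Nat.prime_five).mp (show M ∣ 5 ^ 2 by simpa using hM)
    interval_cases i
    · exact Or.inl (by rw [hMi]; rfl)
    · exact Or.inr (Or.inl (by rw [hMi]; rfl))
    · exact Or.inr (Or.inr (by rw [hMi]; rfl))
  rcases hM' with rfl | rfl | rfl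
  · exact cuspForm_two_gamma0_eq_zero_of_le_ten (by norm_num) f
  · exact cuspForm_two_gamma0_eq_zero_of_le_ten (by norm_num) f
  · have hfd : FiniteDimensional ℂ (CuspForm (Gamma0 25) 2) := finiteDimensional_cuspForm_gamma0 25 2
    have h := finrank_cuspForm_two_eq_genusX0_of_mem (N := 25) (by decide)
    obtain ⟨hμ, hν, h₂, h₃⟩ := gamma0_data_25
    have hg : genusX0 25 = 0 := by rw [genusX0, hμ, hν, h₂, h₃]
    rw [finrank_cuspForm_two_eq_genusX0, hg] at h
    exact finrank_zero_iff_forall_zero.mp h f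

/-- **The prime-power-additive cut (core).** For `E/ℚ` elliptic (global minimal model `W`), `p ≥ 5` of multiplicative reduction with `E[p]`
irreducible, `¬ (ram)` (every multiplicative `ℓ ≠ p` is a `p`-carrier), every prime `≠ r` semistable for `E` and `r^(k+1) ∤ N_E`, PROVIDED the levels
`M ∣ r^k` carry no weight-2 cusp forms on `Γ₀(M)` (`hvan`) and have `p ∤ φ(M)` (`htot`): `p ∤ ord_p(Δ_min)`. Proof = the tree's
`ram_of_semistable_of_irr_of_mult_of_dvd` (Serre–Ribet–Diamond road) with the level bound `N(ρ̄ ⊗ 𝔽̄_p) ∣ r^k` (primes `q ≠ r`: good ⟹ unramified,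
multiplicative ⟹ carrier ⟹ Tate, `p` never; at `r`: `N(ρ̄) ∣ N_E` by Ogg–Saito `hOS`) in place of `N(ρ̄) = 1`, and the end-game of the Dénes Serre road:
`p ∤ φ(M)` forces trivial nebentypus, the newform descends to `Γ₀(M)`, `M ∣ r^k`, and `S₂(Γ₀(M)) = 0`.
[cite: Ribet1990, Thm. 1.1] [cite: Diamond1995RefinedSerre, Thm. 1.1] [cite: Serre1987, §2.8 Prop. 4, §4.1 (4.1.12)] -/
theorem not_dvd_ordp_of_primePowerAdditive_of_not_ram
    (hmod : exists_isNewformOf) (hLL : diamond1995_refinedSerre)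
    (hOS : ∀ (W : WeierstrassCurve ℚ) (ℓ : ℕ) [Fact ℓ.Prime],
      W.artinConductorExponent_tate_eq_conductorExponent_of_isElliptic ℓ)
    (W : WeierstrassCurve ℚ) [W.IsElliptic] [W.IsGloballyMinimal]
    (p : ℕ) [Fact p.Prime] (hp5 : 5 ≤ p) (hmultp : Mult W p) (hirr : Irr W p) (hnram : ¬ Ram W p)
    {r k : ℕ}
    (hsemi : ∀ (ℓ : ℕ) [Fact ℓ.Prime], ℓ ≠ r →
      W.HasGoodReductionAtPrime ℓ ∨ W.HasMultiplicativeReductionAtPrime ℓ)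
    (hk : ¬ r ^ (k + 1) ∣ W.conductorNorm ℤ)
    (htot : ∀ M : ℕ, M ∣ r ^ k → ¬ p ∣ Nat.totient M)
    (hvan : ∀ (M : ℕ) [NeZero M], M ∣ r ^ k → ∀ f : CuspForm (Gamma0 M) 2, f = 0) :
    ¬ p ∣ padicValInt p W.minimalDiscriminantInt := by
  classical
  intro hpeu
  have hp : p.Prime := Fact.out
  have hp2 : p ≠ 2 := by omega
  have hodd : Odd p := hp.odd_of_ne_two hp2
  -- `ord_u Δ_min = v_{ℓ}(Δ_min)` at every place `u` of `ℤ`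
  have hordZ : ∀ u : HeightOneSpectrum ℤ,
      W.ordMinimalDiscriminant u = padicValInt (natGenerator u) W.minimalDiscriminantInt := by
    intro u
    rw [← W.factorization_minimalDiscriminantNorm_holds u,
      minimalDiscriminantNorm_int_eq_natAbs_minimalDiscriminantInt_holds W,
      Nat.factorization_def _ (show (natGenerator u).Prime from (primesEquiv u).2)]
    rfl
  -- `¬ Ram`: at every multiplicative place `u ∤ p` of `ℤ`, `p ∣ ord_u Δ_min`
  have hunr : ∀ u : HeightOneSpectrum ℤ, natGenerator u ≠ p → W.HasMultiplicativeReductionAt u →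
      p ∣ W.ordMinimalDiscriminant u := by
    intro u hup hmu
    by_contra hdiv
    apply hnram
    refine ⟨natGenerator u, ⟨(primesEquiv u).2⟩, hup,
      (hasMultiplicativeReductionAtPrime_primesEquiv_iff_hasMultiplicativeReductionAt W u).mpr hmu,
      ?_⟩
    rwa [hordZ u] at hdiv
  -- every place `≠ r` of `ℤ` is semistable
  have hsstZ : ∀ u : HeightOneSpectrum ℤ, natGenerator u ≠ r →
      W.HasGoodReductionAt u ∨ W.HasMultiplicativeReductionAt u := by
    intro u hu2
    haveI : Fact (natGenerator u).Prime := ⟨(primesEquiv u).2⟩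
    rcases hsemi (natGenerator u) hu2 with hg | hm
    · exact Or.inl ((hasGoodReductionAtPrime_primesEquiv_iff_hasGoodReductionAt W u).mp hg)
    · exact Or.inr
        ((hasMultiplicativeReductionAtPrime_primesEquiv_iff_hasMultiplicativeReductionAt W u).mp hm)
  /- Step 1. A framed model `ρ̄` of `E[p]` and `ρ̄' = ρ̄ ⊗ 𝔽̄_p`: irreducible and odd. -/
  haveI : NeZero ((p : ℕ) : ℚ) := ⟨by exact_mod_cast hp.ne_zero⟩
  obtain ⟨ρ, hρ⟩ := W.exists_isTorsionGaloisRep p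
  letI : TopologicalSpace (AlgebraicClosure (ZMod p)) := ⊥
  haveI : DiscreteTopology (AlgebraicClosure (ZMod p)) := ⟨rfl⟩
  set j : ZMod p →+* AlgebraicClosure (ZMod p) := algebraMap (ZMod p) (AlgebraicClosure (ZMod p))
    with hj
  set ρ' : ModPGaloisRep ℚ (AlgebraicClosure (ZMod p)) 2 :=
    FramedRep.baseChange j continuous_of_discreteTopology ρ with hρ'
  have habs := isAbsolutelyIrreducible_of_hasIrreducibleModPGaloisRep W hp2 hirr hρ
  have hirr' : ρ'.toGaloisRep.IsIrreducible := by
    rw [← ModPGaloisRep.isIrreducible_iff_toGaloisRep]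
    exact habs.isIrreducible_baseChange (AlgebraicClosure (ZMod p)) j _
  have hodd' : FramedGaloisRep.IsOdd ρ' :=
    (ModPGaloisRep.isOdd_of_det_eq_modPCyclotomicCharacterZMod ρ
      (W.det_eq_modPCyclotomicCharacter_of_isTorsionGaloisRep_holds p ρ hρ)).baseChange j _
  /- Step 2. `ρ̄` and `ρ̄'` are modular, `E` being modular (`hmod`). -/
  haveI : NeZero (W.conductorNorm ℤ) := ⟨(conductorNorm_pos_holds W).ne'⟩
  have hWmod : BCDT.IsModular W := exists_isNewformOf_iff.mp hmod W
  have hρmod : ModPGaloisRep.IsModular ρ := hWmod.isModular_of_isTorsionGaloisRep'' hρ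
  have hρ'mod : ModPGaloisRep.IsModular ρ' := hρmod.baseChange_algebraicClosure
  /- Step 3. The canonical local datum at the place `v` above `p`; the weight is `2` (multiplicative, peu ramifié). -/
  obtain ⟨v, hv⟩ : ∃ v : HeightOneSpectrum (𝓞 ℚ), primesEquiv v = ⟨p, hp⟩ :=
    ⟨(primesEquiv (R := 𝓞 ℚ)).symm ⟨p, hp⟩, Equiv.apply_symm_apply _ _⟩
  have hpv' : (p : 𝓞 ℚ) ∈ v.asIdeal := (natCast_mem_asIdeal_iff_primesEquiv_eq v hp).mpr (by rw [hv])
  have hvs : v = (primesEquiv (R := 𝓞 ℚ)).symm ⟨p, hp⟩ := by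
    rw [Equiv.eq_symm_apply]; exact hv
  -- the place of `ℤ` above `p`
  set uZ : HeightOneSpectrum ℤ := (primesEquiv (R := ℤ)).symm ⟨p, hp⟩ with huZ
  have huZp : natGenerator uZ = p := Rat.natGenerator_primesEquiv_symm ⟨p, hp⟩
  have hpe : (primesEquiv uZ : Nat.Primes) = ⟨p, hp⟩ := Equiv.apply_symm_apply _ _
  have hmultZ : W.HasMultiplicativeReductionAt uZ := by
    have h := hasMultiplicativeReductionAtPrime_primesEquiv_iff_hasMultiplicativeReductionAt W uZ
    rw [hpe] at h
    exact h.mp hmultp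
  have hmultv : W.HasMultiplicativeReductionAt v := by
    rw [hvs]; exact hasMultiplicativeReductionAt_of_int W ⟨p, hp⟩ hmultZ
  have hpordv : p ∣ W.ordMinimalDiscriminant v := by
    rw [hvs, ordMinimalDiscriminant_eq_of_int, ← huZ, hordZ uZ, huZp]; exact hpeu
  set loc : LocalRestrictionAt p ρ' :=
    { F := v.adicCompletion ℚ
      residueFieldCard_eq := residueFieldCard_adicCompletion_eq_of_natCast_mem hpv'
      irreducible_natCast := irreducible_natCast_valuativeInteger_adicCompletion_of_natCast_mem hpv'
      rep := FramedGaloisRep.restrictField (v.adicCompletion ℚ) ρ'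
      rep_eq_restrictField := rfl } with hloc
  obtain ⟨ι⟩ := nonempty_ringHom_residue (k := AlgebraicClosure (ZMod p)) p (v.adicCompletion ℚ)
    (residueFieldCard_adicCompletion_eq_of_natCast_mem hpv')
  have hw : (serreWeight p ρ' loc ι : ℤ) = 2 := by
    have h2 : serreWeight p ρ' loc ι = 2 :=
      serreWeight_eq_two_of_hasMultiplicativeReductionAt_of_dvd W p hp2 v hpv' hmultv hpordv hρ
        (AlgebraicClosure (ZMod p)) j ι
    rw [h2]; rfl
  /- Step 4. Level-lowering: `ρ̄'` arises from a newform `f` of weight `2` and level `M ∣ N(ρ̄')`. -/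
  obtain ⟨M, hMz, hMN, f, ιf, hf, hgal⟩ :=
    hLL p hodd (AlgebraicClosure (ZMod p)) ρ' hirr' hodd' hρ'mod loc ι
  revert hgal hf ιf f
  rw [hw]
  intro f ιf hf hgal
  /- Step 5. `N(ρ̄') ∣ r^k`: no prime `q ≠ r` divides it (good ⟹ unramified; multiplicative ⟹ `p`-carrier ⟹ Tate; `p` itself never), and
     `N(ρ̄') ∣ N_E` with `r^(k+1) ∤ N_E` (Ogg–Saito). -/
  have hN0 : serreLevel p ρ' ≠ 0 := fun h0' ↦ not_dvd_serreLevel p ρ' (h0' ▸ dvd_zero p)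
  have hlevN : serreLevel p ρ' ∣ W.conductorNorm ℤ :=
    serreLevel_baseChange_dvd_conductorNorm_of_tate hOS W p ρ hρ (AlgebraicClosure (ZMod p)) j
  have hNrk : serreLevel p ρ' ∣ r ^ k := by
    refine dvd_primePow_of_forall_prime_dvd_eq hN0 (fun q hq hqN ↦ ?_) hlevN hk
    by_contra hq2
    rcases eq_or_ne q p with rfl | hqp
    · exact not_dvd_serreLevel q ρ' hqN
    · obtain ⟨u, hu⟩ : ∃ u : HeightOneSpectrum ℤ, natGenerator u = q :=
        ⟨(primesEquiv (R := ℤ)).symm ⟨q, hq⟩, Rat.natGenerator_primesEquiv_symm ⟨q, hq⟩⟩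
      rcases hsstZ u (by rw [hu]; exact hq2) with hgu | hmu
      · exact not_dvd_serreLevel_baseChange_of_hasGoodReductionAt_int W p hρ j _ u
          (by rw [hu]; exact hqp) hgu (by rw [hu]; exact hqN)
      · exact not_dvd_serreLevel_baseChange_of_hasMultiplicativeReductionAt_of_dvd_int W p hρ j _ u
          (by rw [hu]; exact hqp) hmu (hunr u (by rw [hu]; exact hqp) hmu) (by rw [hu]; exact hqN)
  /- Step 6. `M ∣ r^k`; `p ∤ φ(M)` so the nebentypus of `f` is trivial; descend to `Γ₀(M)`, where there are no weight-2 cusp forms. -/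
  haveI : NeZero M := hMz
  have hMrk : M ∣ r ^ k := hMN.trans hNrk
  have hε : nebentypus f = 1 :=
    nebentypus_eq_one_of_isGaloisRepOfNewform1Int_of_not_dvd_totient W hρ j (htot M hMrk) ιf hgal
      (W.conductorNorm ℤ)
      fun q _ hqB hqd ↦ absurd (Nat.le_of_dvd (conductorNorm_pos_holds W) hqd) (not_le.mpr hqB)
  obtain ⟨g, hg, -⟩ := exists_isNewform0_coe_eq_of_nebentypus_eq_one hf hε
  exact hg.ne_zero (hvan M hMrk g)

/-- **The 2-power cut** (`r = 2`, `k = 4`): every ODD prime semistable and `2⁵ ∤ N_E` ⟹ `p ∤ ord_p(Δ_min)`; levels `M ∣ 16` have `φ(M) ∣ 8`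
(`not_dvd_totient_of_dvd_thirtyTwo`) and `S₂(Γ₀(M)) = 0` (`cuspForm_two_gamma0_eq_zero_of_dvd_sixteen`). [cite: Diamond1995RefinedSerre, Thm. 1.1] -/
theorem not_dvd_ordp_of_twoPowerAdditive_of_not_ram
    (hmod : exists_isNewformOf) (hLL : diamond1995_refinedSerre)
    (hOS : ∀ (W : WeierstrassCurve ℚ) (ℓ : ℕ) [Fact ℓ.Prime],
      W.artinConductorExponent_tate_eq_conductorExponent_of_isElliptic ℓ)
    (W : WeierstrassCurve ℚ) [W.IsElliptic] [W.IsGloballyMinimal]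
    (p : ℕ) [Fact p.Prime] (hp5 : 5 ≤ p) (hmultp : Mult W p) (hirr : Irr W p) (hnram : ¬ Ram W p)
    (hodd2 : ∀ (ℓ : ℕ) [Fact ℓ.Prime], ℓ ≠ 2 →
      W.HasGoodReductionAtPrime ℓ ∨ W.HasMultiplicativeReductionAtPrime ℓ)
    (h32 : ¬ 2 ^ 5 ∣ W.conductorNorm ℤ) :
    ¬ p ∣ padicValInt p W.minimalDiscriminantInt :=
  have hp : p.Prime := Fact.out
  not_dvd_ordp_of_primePowerAdditive_of_not_ram hmod hLL hOS W p hp5 hmultp hirr hnram (k := 4)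
    hodd2 h32
    (fun M hM ↦ not_dvd_totient_of_dvd_thirtyTwo (hM.trans (by norm_num)) hp (by omega))
    (fun M _ hM f ↦ cuspForm_two_gamma0_eq_zero_of_dvd_sixteen hM f)

/-- **The 3-square cut** (`r = 3`, `k = 2`): every prime `≠ 3` semistable and `3³ ∤ N_E` (so `N_add ∣ 9`) ⟹ `p ∤ ord_p(Δ_min)`; levels `M ∣ 9` have
`φ(M) ∈ {1, 2, 6}` and `S₂(Γ₀(M)) = 0` (`cuspForm_two_gamma0_eq_zero_of_le_ten`). Contains the semistable cut (with Ogg–Saito as an extra input).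
[cite: Diamond1995RefinedSerre, Thm. 1.1] -/
theorem not_dvd_ordp_of_threeSquareAdditive_of_not_ram
    (hmod : exists_isNewformOf) (hLL : diamond1995_refinedSerre)
    (hOS : ∀ (W : WeierstrassCurve ℚ) (ℓ : ℕ) [Fact ℓ.Prime],
      W.artinConductorExponent_tate_eq_conductorExponent_of_isElliptic ℓ)
    (W : WeierstrassCurve ℚ) [W.IsElliptic] [W.IsGloballyMinimal]
    (p : ℕ) [Fact p.Prime] (hp5 : 5 ≤ p) (hmultp : Mult W p) (hirr : Irr W p) (hnram : ¬ Ram W p)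
    (hsemi3 : ∀ (ℓ : ℕ) [Fact ℓ.Prime], ℓ ≠ 3 →
      W.HasGoodReductionAtPrime ℓ ∨ W.HasMultiplicativeReductionAtPrime ℓ)
    (h27 : ¬ 3 ^ 3 ∣ W.conductorNorm ℤ) :
    ¬ p ∣ padicValInt p W.minimalDiscriminantInt :=
  have hp : p.Prime := Fact.out
  not_dvd_ordp_of_primePowerAdditive_of_not_ram hmod hLL hOS W p hp5 hmultp hirr hnram (k := 2)
    hsemi3 h27
    (fun M hM ↦ not_dvd_totient_of_dvd_nine (by simpa using hM) hp hp5)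
    (fun M _ hM f ↦ cuspForm_two_gamma0_eq_zero_of_le_ten
      ((Nat.le_of_dvd (by norm_num) hM).trans (by norm_num)) f)

/-- **The 5-square cut** (`r = 5`, `k = 2`, `p ≥ 7`): every prime `≠ 5` semistable and `5³ ∤ N_E` (so `N_add ∣ 25`) ⟹ `p ∤ ord_p(Δ_min)`; levels
`M ∣ 25` have `φ(M) ∈ {1, 4, 20}` and `S₂(Γ₀(M)) = 0`. (At `p = 5` the locus consists of semistable curves: `not_dvd_ordp_of_locusFive_of_not_ram`.)
[cite: Diamond1995RefinedSerre, Thm. 1.1] [cite: DiamondShurman2005, Thm. 3.5.1] -/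
theorem not_dvd_ordp_of_fiveSquareAdditive_of_not_ram
    (hmod : exists_isNewformOf) (hLL : diamond1995_refinedSerre)
    (hOS : ∀ (W : WeierstrassCurve ℚ) (ℓ : ℕ) [Fact ℓ.Prime],
      W.artinConductorExponent_tate_eq_conductorExponent_of_isElliptic ℓ)
    (W : WeierstrassCurve ℚ) [W.IsElliptic] [W.IsGloballyMinimal]
    (p : ℕ) [Fact p.Prime] (hp7 : 7 ≤ p) (hmultp : Mult W p) (hirr : Irr W p) (hnram : ¬ Ram W p)
    (hsemi5 : ∀ (ℓ : ℕ) [Fact ℓ.Prime], ℓ ≠ 5 →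
      W.HasGoodReductionAtPrime ℓ ∨ W.HasMultiplicativeReductionAtPrime ℓ)
    (h125 : ¬ 5 ^ 3 ∣ W.conductorNorm ℤ) :
    ¬ p ∣ padicValInt p W.minimalDiscriminantInt :=
  have hp : p.Prime := Fact.out
  not_dvd_ordp_of_primePowerAdditive_of_not_ram hmod hLL hOS W p (by omega) hmultp hirr hnram (k := 2)
    hsemi5 h125
    (fun M hM ↦ not_dvd_totient_of_dvd_twentyFive (by simpa using hM) hp hp7)
    (fun M _ hM f ↦ cuspForm_two_gamma0_eq_zero_of_dvd_twentyFive (by simpa using hM) f)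

/-- **The 5-square locus at every `p ≥ 5`**: at `p = 5` the curve is semistable (`5` is multiplicative), so §1 applies (no Ogg–Saito); at `p ≥ 7` the
5-square cut. -/
theorem not_dvd_ordp_of_locusFive_of_not_ram
    (hmod : exists_isNewformOf) (hLL : diamond1995_refinedSerre)
    (hOS : ∀ (W : WeierstrassCurve ℚ) (ℓ : ℕ) [Fact ℓ.Prime],
      W.artinConductorExponent_tate_eq_conductorExponent_of_isElliptic ℓ)
    (W : WeierstrassCurve ℚ) [W.IsElliptic] [W.IsGloballyMinimal]
    (p : ℕ) [Fact p.Prime] (hp5 : 5 ≤ p) (hmultp : Mult W p) (hirr : Irr W p) (hnram : ¬ Ram W p)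
    (hsemi5 : ∀ (ℓ : ℕ) [Fact ℓ.Prime], ℓ ≠ 5 →
      W.HasGoodReductionAtPrime ℓ ∨ W.HasMultiplicativeReductionAtPrime ℓ)
    (h125 : ¬ 5 ^ 3 ∣ W.conductorNorm ℤ) :
    ¬ p ∣ padicValInt p W.minimalDiscriminantInt := by
  have hp : p.Prime := Fact.out
  by_cases hp5e : p = 5
  · subst hp5e
    have hsst : Semistable W := fun ℓ hℓ ↦ by
      haveI : Fact ℓ.Prime := ⟨hℓ⟩
      by_cases h5 : ℓ = 5
      · subst h5; exact Or.inr hmultp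
      · exact hsemi5 ℓ h5
    exact not_dvd_ordp_of_semistable_of_not_ram hmod hLL W 5 hp5 hmultp hirr hsst hnram
  · have hp7 : 7 ≤ p := by
      rcases (show 6 ≤ p by omega).eq_or_lt with h6 | h6
      · exact absurd hp (h6 ▸ by decide)
      · omega
    exact not_dvd_ordp_of_fiveSquareAdditive_of_not_ram hmod hLL hOS W p hp7 hmultp hirr hnram hsemi5 h125

/-- **The three genus-zero cuts in one statement.** On 19715's locus (`p ≥ 5` multiplicative, `E[p]` irreducible, no (ram) prime), if for SOME
`r ∈ {2, 3, 5}` every prime `≠ r` is semistable for `E` and `r^(k_r+1) ∤ N_E` (`k₂ = 4`, `k₃ = k₅ = 2`; i.e. the additive conductor of `E` is `1`, `4`, `8`,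
`16`, `9` or `25`), then `p ∤ ord_p(Δ_min)` — the self-carrier is excluded. [cite: Ribet1990, Thm. 1.1] [cite: Diamond1995RefinedSerre, Thm. 1.1] -/
theorem not_dvd_ordp_of_genusZeroAdditive_of_not_ram
    (hmod : exists_isNewformOf) (hLL : diamond1995_refinedSerre)
    (hOS : ∀ (W : WeierstrassCurve ℚ) (ℓ : ℕ) [Fact ℓ.Prime],
      W.artinConductorExponent_tate_eq_conductorExponent_of_isElliptic ℓ)
    (W : WeierstrassCurve ℚ) [W.IsElliptic] [W.IsGloballyMinimal]
    (p : ℕ) [Fact p.Prime] (hp5 : 5 ≤ p) (hmultp : Mult W p) (hirr : Irr W p) (hnram : ¬ Ram W p)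
    (hlocus : ((∀ (ℓ : ℕ) [Fact ℓ.Prime], ℓ ≠ 2 → W.HasGoodReductionAtPrime ℓ ∨ W.HasMultiplicativeReductionAtPrime ℓ) ∧
          ¬ 2 ^ 5 ∣ W.conductorNorm ℤ) ∨
      ((∀ (ℓ : ℕ) [Fact ℓ.Prime], ℓ ≠ 3 → W.HasGoodReductionAtPrime ℓ ∨ W.HasMultiplicativeReductionAtPrime ℓ) ∧
          ¬ 3 ^ 3 ∣ W.conductorNorm ℤ) ∨
      ((∀ (ℓ : ℕ) [Fact ℓ.Prime], ℓ ≠ 5 → W.HasGoodReductionAtPrime ℓ ∨ W.HasMultiplicativeReductionAtPrime ℓ) ∧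
          ¬ 5 ^ 3 ∣ W.conductorNorm ℤ)) :
    ¬ p ∣ padicValInt p W.minimalDiscriminantInt := by
  rcases hlocus with ⟨h, hk⟩ | ⟨h, hk⟩ | ⟨h, hk⟩
  · exact not_dvd_ordp_of_twoPowerAdditive_of_not_ram hmod hLL hOS W p hp5 hmultp hirr hnram h hk
  · exact not_dvd_ordp_of_threeSquareAdditive_of_not_ram hmod hLL hOS W p hp5 hmultp hirr hnram h hk
  · exact not_dvd_ordp_of_locusFive_of_not_ram hmod hLL hOS W p hp5 hmultp hirr hnram h hk

end Summit.BirchSwinnertonDyer.BirchSwinnertonDyer.Theorems.EulerHalfLevelLoweringCut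

end
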